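import Literature.NumberTheory.Automorphic.HyperspecialUnitarySatakeTransformAdicCompletion
import Literature.NumberTheory.Automorphic.SymplecticSatakeTransformAdicCompletion
import Literature.NumberTheory.Automorphic.HyperspecialUnitarySatakeInjective
import Literature.NumberTheory.Automorphic.SymplecticCartanIwasawaUniqueness
import Literature.NumberTheory.Automorphic.HyperspecialUnitaryHeckeEigencharacter
import Mathlib.Combinatorics.Nullstellensatz
import HarnessLib

/-!
# The unramified eigencharacters separate the spherical Hecke algebra: `λ_β(T) = 0` for every torus parameter `β ∈ (ℂˣ)ⁿ`
# forces `T = 0` — for `U_N(E/K)` (every `N`) and `Sp_{2n}(K)` (every `n`), locally and at the places of a number field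
# (Cartier §IV Thm. 4.1, Cor. 4.2; a Laurent polynomial vanishing on the torus is zero, Alon Lemma 2.1)

Topic `NumberTheory/Automorphic`; namespaces `Literature.NumberTheory.Automorphic[.HermitianLattice.UnramifiedLocalConjDatum
| .SymplecticCartan | .UnitaryGroup]` (lane `lit-hodgefound`, Track 2 foundations; seat `lit-hodgefound-p11`, generation 47,
row g47-#11).  THEOREMS ONLY: no definition, no named fact, no instance, no notation.

## The mathematics

Let `𝒮 : ℋ(G, K₀; ℂ) → ℂ[Λ]`, `Λ = ℤⁿ`, be the Satake transform and `λ_β = ev_β ∘ 𝒮` (`β ∈ (ℂˣ)ⁿ`,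
`ev_β(x^m) = ∏ β_i^{m_i}`) the unramified eigencharacters.  **(1) A Laurent polynomial `f ∈ ℂ[ℤⁿ]` with `f(β) = 0` for every
`β ∈ (ℂˣ)ⁿ` is zero** (`eq_zero_of_forall_laurentEvalAt_eq_zero`): multiply by the monomial `x^{(B,…,B)}`, `B` a bound for the
`|m_i|` on the support, to get an honest polynomial `P = Σ_m f_m X^{m + B}` with `deg_{X_i} P ≤ 2B` vanishing on `S^n`,
`S = {1, 2, …, 2B+1} ⊂ ℂˣ`; by Alon's Lemma 2.1 (Mathlib `MvPolynomial.eq_zero_of_eval_zero_at_prod_finset`) `P = 0`, and the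
coefficients of `P` are those of `f`.  **(2)** Since `𝒮` is injective (Cartier Thm. 4.1, injectivity half — in the tree for `U_N`,
`Sp_{2n}`, and at the places), **`λ_β(T) = 0 ∀ β ⟹ T = 0`**, i.e. **`S = T ⟺ λ_β(S) = λ_β(T) ∀ β`: a Hecke operator is determined
by its eigenvalues on the unramified principal series** (Cartier Cor. 4.2: `Hom(ℋ, ℂ) = {λ_β}` and `ℋ ↪ Fun((ℂˣ)ⁿ/W, ℂ)`).

## What is formalised (theorems only)

* §1 **`eq_zero_of_forall_laurentEvalAt_eq_zero`**, `eq_of_forall_laurentEvalAt_eq` (`ℂ[ℤⁿ]`, any `n`).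
* §2 (`U_N(E/K)`, every `N`, `hd : UnramifiedLocalConjDatum σ ϖ`) **`eq_zero_of_forall_heckeEigencharacter_eq_zero`**,
  **`eq_iff_forall_heckeEigencharacter_eq`**.
* §3 (`Sp_{2n}(K)`, every `n`, `q ∈ ℂˣ`) **`eq_zero_of_forall_symplecticHeckeEigencharacter_eq_zero`**,
  `eq_iff_forall_symplecticHeckeEigencharacter_eq`.
* §4 (places of number fields) `eq_zero_of_forall_unitaryHeckeEigencharacterAdic_eq_zero`,
  `eq_iff_forall_unitaryHeckeEigencharacterAdic_eq`, `eq_zero_of_forall_symplecticHeckeEigencharacterAdic_eq_zero`,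
  `eq_iff_forall_symplecticHeckeEigencharacterAdic_eq`.

## References
* [CartierCorvallis1979] P. Cartier, *Representations of 𝔭-adic groups: a survey*, PSPM 33.1 (1979), §IV (4.2), Thm. 4.1, Cor. 4.2.
* [Alon1999] N. Alon, *Combinatorial Nullstellensatz*, Combin. Probab. Comput. 8 (1999), Lemma 2.1 (a polynomial with
  `deg_{x_i} P < #S_i` vanishing on `S_1 × ⋯ × S_n` is zero).
-/

noncomputable section

open scoped Valued WithZero Matrix MatrixGroups
open Matrix MonoidAlgebra Representation NumberField IsDedekindDomain

namespace Literature.NumberTheory.Automorphic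

/-! ## §1 A Laurent polynomial vanishing on `(ℂˣ)ⁿ` is zero -/

/-- **A Laurent polynomial `f ∈ ℂ[ℤⁿ]` with `f(β) = 0` for all `β ∈ (ℂˣ)ⁿ` is zero**: shift by `x^{(B,…,B)}` to a polynomial
`P` with `deg_{X_i} P ≤ 2B` vanishing on `{1,…,2B+1}ⁿ`, and apply Alon's Lemma 2.1. [cite: Alon1999, Lemma 2.1]
[cite: CartierCorvallis1979, §IV Thm. 4.1] -/
theorem eq_zero_of_forall_laurentEvalAt_eq_zero {n : ℕ} (f : AddMonoidAlgebra ℂ (Fin n → ℤ))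
    (h : ∀ z : Fin n → ℂˣ, laurentEvalAt z f = 0) : f = 0 := by
  classical
  -- a common bound `B` for the exponents on the support
  obtain ⟨B, hB⟩ : ∃ B : ℕ, ∀ μ ∈ f.coeff.support, ∀ i, (μ i).natAbs ≤ B :=
    ⟨f.coeff.support.sup fun μ => Finset.univ.sup fun i => (μ i).natAbs, fun μ hμ i =>
      (Finset.le_sup (f := fun i => (μ i).natAbs) (Finset.mem_univ i)).trans
        (Finset.le_sup (f := fun μ : Fin n → ℤ => Finset.univ.sup fun i => (μ i).natAbs) hμ)⟩
  -- the shifted exponents `μ + B ≥ 0` as monomials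
  let d : (Fin n → ℤ) → (Fin n →₀ ℕ) := fun μ => Finsupp.equivFunOnFinite.symm fun i => (μ i + B).toNat
  have hd_apply : ∀ μ i, d μ i = (μ i + B).toNat := fun μ i => rfl
  have hd_inj : ∀ μ ∈ f.coeff.support, ∀ ν ∈ f.coeff.support, d μ = d ν → μ = ν := by
    intro μ hμ ν hν hμν
    funext i
    have h1 := DFunLike.congr_fun hμν i
    rw [hd_apply, hd_apply] at h1
    have hμi := hB μ hμ i
    have hνi := hB ν hν i
    omega
  -- the polynomial `P = Σ_μ f_μ X^{μ + B}`
  set P : MvPolynomial (Fin n) ℂ := ∑ μ ∈ f.coeff.support, MvPolynomial.monomial (d μ) (f.coeff μ) with hP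
  have hPcoeff : ∀ μ ∈ f.coeff.support, P.coeff (d μ) = f.coeff μ := by
    intro μ hμ
    rw [hP, MvPolynomial.coeff_sum, Finset.sum_eq_single μ (fun ν hν hne => ?_) (fun hμ' => absurd hμ hμ'),
      MvPolynomial.coeff_monomial, if_pos rfl]
    rw [MvPolynomial.coeff_monomial, if_neg (fun heq => hne (hd_inj ν hν μ hμ heq))]
  have hPsupp : ∀ m ∈ P.support, ∃ μ ∈ f.coeff.support, m = d μ := by
    intro m hm
    by_contra hne
    push Not at hne
    rw [MvPolynomial.mem_support_iff, hP, MvPolynomial.coeff_sum, Finset.sum_eq_zero (fun ν hν => ?_)] at hm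
    · exact hm rfl
    · rw [MvPolynomial.coeff_monomial, if_neg (fun heq => hne ν hν heq.symm)]
  -- `P(z) = (∏ z_i^B) · f(z)` on the torus
  have hPeval : ∀ z : Fin n → ℂˣ, MvPolynomial.eval (fun i => (z i : ℂ)) P = (∏ i, (z i : ℂ) ^ B) * laurentEvalAt z f := by
    intro z
    rw [hP, map_sum]
    conv_rhs => rw [← AddMonoidAlgebra.sum_coeff_single f, Finsupp.sum, map_sum, Finset.mul_sum]
    refine Finset.sum_congr rfl fun μ hμ => ?_
    rw [MvPolynomial.eval_monomial, laurentEvalAt_single, Finsupp.prod_fintype _ _ (fun i => pow_zero _), mul_left_comm,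
      ← Finset.prod_mul_distrib]
    congr 1
    refine Finset.prod_congr rfl fun i _ => ?_
    have hi : 0 ≤ μ i + B := by have := hB μ hμ i; omega
    rw [hd_apply, ← zpow_natCast, Int.toNat_of_nonneg hi, zpow_add₀ (Units.ne_zero _), zpow_natCast, mul_comm]
  -- Alon's Lemma 2.1 on `{1, …, 2B+1}ⁿ`
  have hP0 : P = 0 := by
    refine MvPolynomial.eq_zero_of_eval_zero_at_prod_finset P
      (fun _ => (Finset.range (2 * B + 1)).image fun j : ℕ => ((j : ℂ) + 1)) (fun i => ?_) (fun x hx => ?_)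
    · rw [Finset.card_image_of_injective _ (fun a b hab => by exact_mod_cast (add_left_injective _ hab : (a : ℂ) = b)),
        Finset.card_range, MvPolynomial.degreeOf_lt_iff (by omega)]
      intro m hm
      obtain ⟨μ, hμ, rfl⟩ := hPsupp m hm
      rw [hd_apply]
      have := hB μ hμ i
      omega
    · have hx0 : ∀ i, x i ≠ 0 := fun i => by
        obtain ⟨j, -, hj⟩ := Finset.mem_image.1 (hx i)
        rw [← hj]
        exact_mod_cast Nat.succ_ne_zero j
      have h1 := hPeval fun i => Units.mk0 (x i) (hx0 i)
      simp only [Units.val_mk0] at h1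
      rw [h, mul_zero] at h1
      exact h1
  -- the coefficients of `P` are those of `f`
  rw [← AddMonoidAlgebra.coeff_eq_zero]
  ext μ
  rw [Finsupp.zero_apply]
  by_contra hμ
  have h1 := hPcoeff μ (Finsupp.mem_support_iff.2 hμ)
  rw [hP0, MvPolynomial.coeff_zero] at h1
  exact hμ h1.symm

/-- **Two Laurent polynomials agreeing on `(ℂˣ)ⁿ` are equal.** [cite: Alon1999, Lemma 2.1] -/
theorem eq_of_forall_laurentEvalAt_eq {n : ℕ} {f g : AddMonoidAlgebra ℂ (Fin n → ℤ)}
    (h : ∀ z : Fin n → ℂˣ, laurentEvalAt z f = laurentEvalAt z g) : f = g :=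
  sub_eq_zero.1 (eq_zero_of_forall_laurentEvalAt_eq_zero _ fun z => by rw [map_sub, h, sub_self])

end Literature.NumberTheory.Automorphic

/-! ## §2 `U_N(E/K)`: the `λ_β`, `β ∈ (ℂˣ)^N`, separate `ℋ(U(σ, J₀), K₀; ℂ)` (every `N`) -/

namespace Literature.NumberTheory.Automorphic.HermitianLattice.UnramifiedLocalConjDatum

open Literature.NumberTheory.Automorphic.CartanUnique Literature.NumberTheory.Automorphic.SymplecticCartan
  Literature.NumberTheory.Automorphic

variable {K : Type*} [Field K] [Valued K ℤᵐ⁰] {σ : K →+* K} {ϖ : K} {N : ℕ} [Finite 𝓀[K]]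

/-- **THE UNRAMIFIED EIGENCHARACTERS SEPARATE `ℋ(U(σ, J₀), K₀; ℂ)`** (every `N`): `λ_β(T) = 0` for every torus parameter
`β ∈ (ℂˣ)^N` forces `T = 0` (`𝒮` is injective and `𝒮(T)` vanishes on the torus). [cite: CartierCorvallis1979, §IV Thm. 4.1, Cor. 4.2] -/
theorem eq_zero_of_forall_heckeEigencharacter_eq_zero (hd : UnramifiedLocalConjDatum σ ϖ)
    {T : heckeAlgebra ℂ (unitaryGroupOfForm σ ((StdForm.antidiagonal N).over K)) (unitaryInt σ ((StdForm.antidiagonal N).over K))}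
    (h : ∀ β : Fin N → ℂˣ, hd.heckeEigencharacter β T = 0) : T = 0 :=
  (injective_iff_map_eq_zero _).1 hd.satakeTransform_injective T
    (eq_zero_of_forall_laurentEvalAt_eq_zero _ fun β => by rw [← hd.heckeEigencharacter_apply β T, h])

/-- **A Hecke operator on `U(σ, J₀)` is determined by its unramified eigenvalues**: `S = T ⟺ λ_β(S) = λ_β(T)` for all
`β ∈ (ℂˣ)^N`. [cite: CartierCorvallis1979, §IV Thm. 4.1, Cor. 4.2] -/
theorem eq_iff_forall_heckeEigencharacter_eq (hd : UnramifiedLocalConjDatum σ ϖ)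
    (S T : heckeAlgebra ℂ (unitaryGroupOfForm σ ((StdForm.antidiagonal N).over K)) (unitaryInt σ ((StdForm.antidiagonal N).over K))) :
    S = T ↔ ∀ β : Fin N → ℂˣ, hd.heckeEigencharacter β S = hd.heckeEigencharacter β T :=
  ⟨fun h _ => h ▸ rfl, fun h => sub_eq_zero.1
    (hd.eq_zero_of_forall_heckeEigencharacter_eq_zero fun β => by rw [map_sub, h, sub_self])⟩

end Literature.NumberTheory.Automorphic.HermitianLattice.UnramifiedLocalConjDatum

/-! ## §3 `Sp_{2n}(K)`: the `λ_{χ_z}`, `z ∈ (ℂˣ)ⁿ`, separate `ℋ(Sp_{2n}(K), Sp_{2n}(𝒪); ℂ)` (every `n`) -/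

namespace Literature.NumberTheory.Automorphic.SymplecticCartan

open Literature.NumberTheory.Automorphic.CartanUnique Literature.NumberTheory.Automorphic

section Local

variable {K : Type*} [Field K] [Valued K ℤᵐ⁰] {ϖ : K} {n : ℕ} (hϖ : Valued.v ϖ = WithZero.exp (-1 : ℤ))
include hϖ

/-- **THE UNRAMIFIED EIGENCHARACTERS SEPARATE `ℋ(Sp_{2n}(K), Sp_{2n}(𝒪); ℂ)`** (every `n`, every `q ∈ ℂˣ`): `λ_{q,χ_z}(T) = 0`
for all `z ∈ (ℂˣ)ⁿ` forces `T = 0`. [cite: CartierCorvallis1979, §IV Thm. 4.1, Cor. 4.2] -/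
theorem eq_zero_of_forall_symplecticHeckeEigencharacter_eq_zero (q : ℂˣ)
    {T : heckeAlgebra ℂ (symplecticGroup (Fin n) K) (symplecticInt (Fin n) K)}
    (h : ∀ z : Fin n → ℂˣ, symplecticHeckeEigencharacter hϖ q (laurentMonomialHom z) T = 0) : T = 0 :=
  (injective_iff_map_eq_zero _).1 (symplecticSatakeTransform_injective_of_commRing hϖ q) T
    (eq_zero_of_forall_laurentEvalAt_eq_zero _ fun z => by
      have h1 := h z
      rw [symplecticHeckeEigencharacter, IsIwasawaExponent.heckeEigencharacter_apply, ← symplecticSatakeTransform_eq] at h1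
      exact h1)

/-- **A Hecke operator on `Sp_{2n}(K)` is determined by its unramified eigenvalues.** [cite: CartierCorvallis1979, §IV Thm. 4.1, Cor. 4.2] -/
theorem eq_iff_forall_symplecticHeckeEigencharacter_eq (q : ℂˣ)
    (S T : heckeAlgebra ℂ (symplecticGroup (Fin n) K) (symplecticInt (Fin n) K)) :
    S = T ↔ ∀ z : Fin n → ℂˣ,
      symplecticHeckeEigencharacter hϖ q (laurentMonomialHom z) S = symplecticHeckeEigencharacter hϖ q (laurentMonomialHom z) T :=
  ⟨fun h _ => h ▸ rfl, fun h => sub_eq_zero.1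
    (eq_zero_of_forall_symplecticHeckeEigencharacter_eq_zero hϖ q fun z => by rw [map_sub, h, sub_self])⟩

end Local

section NumberField

variable (F : Type*) [Field F] [NumberField F] (v : HeightOneSpectrum (𝓞 F)) {n : ℕ}

/-- **At every finite place `v`: `λ_{v,χ_z}(T) = 0` for all `z ∈ (ℂˣ)ⁿ` forces `T = 0` in `ℋ(Sp_{2n}(F_v), Sp_{2n}(𝒪_v); ℂ)`.**
[cite: CartierCorvallis1979, §IV Thm. 4.1, Cor. 4.2] -/
theorem eq_zero_of_forall_symplecticHeckeEigencharacterAdic_eq_zero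
    {T : heckeAlgebra ℂ (symplecticGroup (Fin n) (v.adicCompletion F)) (symplecticInt (Fin n) (v.adicCompletion F))}
    (h : ∀ z : Fin n → ℂˣ, symplecticHeckeEigencharacterAdic F v (laurentMonomialHom z) T = 0) : T = 0 :=
  eq_zero_of_forall_symplecticHeckeEigencharacter_eq_zero (v_adicUniformizer F v) (residueNormUnit F v) h

/-- **A Hecke operator on `Sp_{2n}(F_v)` is determined by its unramified eigenvalues**, at every finite place.
[cite: CartierCorvallis1979, §IV Thm. 4.1, Cor. 4.2] -/
theorem eq_iff_forall_symplecticHeckeEigencharacterAdic_eq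
    (S T : heckeAlgebra ℂ (symplecticGroup (Fin n) (v.adicCompletion F)) (symplecticInt (Fin n) (v.adicCompletion F))) :
    S = T ↔ ∀ z : Fin n → ℂˣ,
      symplecticHeckeEigencharacterAdic F v (laurentMonomialHom z) S = symplecticHeckeEigencharacterAdic F v (laurentMonomialHom z) T :=
  eq_iff_forall_symplecticHeckeEigencharacter_eq (v_adicUniformizer F v) (residueNormUnit F v) S T

end NumberField

end Literature.NumberTheory.Automorphic.SymplecticCartan

/-! ## §4 `U_N(E_w/F_v)` at the inert unramified places of a quadratic extension of number fields -/

namespace Literature.NumberTheory.Automorphic.UnitaryGroup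

open Literature.NumberTheory.Automorphic.HermitianLattice Literature.NumberTheory.Automorphic

variable {F E : Type} [Field F] [NumberField F] [Field E] [NumberField E] [Algebra F E] [Algebra.IsQuadraticExtension F E]
  (c : E ≃ₐ[F] E) (hc1 : c ≠ 1) (v : HeightOneSpectrum (𝓞 F)) (w : PlacesOver E v) (hw : c • w.1 = w.1)
  (hv : Algebra.IsUnramifiedIn (𝓞 E) v.asIdeal) {N : ℕ}

/-- **At every inert unramified place `w`: `λ_{w,β}(T) = 0` for all `β ∈ (ℂˣ)^N` forces `T = 0` in `ℋ(U_N(E_w), K₀; ℂ)`.**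
[cite: CartierCorvallis1979, §IV Thm. 4.1, Cor. 4.2] -/
theorem eq_zero_of_forall_unitaryHeckeEigencharacterAdic_eq_zero
    {T : heckeAlgebra ℂ (unitaryGroupOfForm (galAdicCompletionMap (L := E) c hw)
        ((StdForm.antidiagonal N).over (w.1.adicCompletion E)))
      (unitaryInt (galAdicCompletionMap (L := E) c hw) ((StdForm.antidiagonal N).over (w.1.adicCompletion E)))}
    (h : ∀ β : Fin N → ℂˣ, unitaryHeckeEigencharacterAdic c hc1 v w hw hv β T = 0) : T = 0 :=
  (injective_iff_map_eq_zero _).1 (unitarySatakeTransformAdic_injective c hc1 v w hw hv) T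
    (eq_zero_of_forall_laurentEvalAt_eq_zero _ fun β => by rw [← unitaryHeckeEigencharacterAdic_apply c hc1 v w hw hv β T, h])

/-- **A Hecke operator on `U_N(E_w)` is determined by its unramified eigenvalues**, at every inert unramified place.
[cite: CartierCorvallis1979, §IV Thm. 4.1, Cor. 4.2] -/
theorem eq_iff_forall_unitaryHeckeEigencharacterAdic_eq
    (S T : heckeAlgebra ℂ (unitaryGroupOfForm (galAdicCompletionMap (L := E) c hw)
        ((StdForm.antidiagonal N).over (w.1.adicCompletion E)))
      (unitaryInt (galAdicCompletionMap (L := E) c hw) ((StdForm.antidiagonal N).over (w.1.adicCompletion E)))) :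
    S = T ↔ ∀ β : Fin N → ℂˣ,
      unitaryHeckeEigencharacterAdic c hc1 v w hw hv β S = unitaryHeckeEigencharacterAdic c hc1 v w hw hv β T :=
  ⟨fun h _ => h ▸ rfl, fun h => sub_eq_zero.1
    (eq_zero_of_forall_unitaryHeckeEigencharacterAdic_eq_zero c hc1 v w hw hv fun β => by rw [map_sub, h, sub_self])⟩

end Literature.NumberTheory.Automorphic.UnitaryGroup
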